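import Mathlib
import Literature.Computability.AlgebraicComplexity.PIProof

/-!
# Route ProofCarryingSymmetry — crux `RestorationQP`, line `registered`: proof DAGs in Hrubeš–Tzameret systems

Necessity of the provability stub T′ (`stub_invarianceProvableQP'`), part 1.  The lead's necessity
theorem (`RestorationQP ⇒` quasi-polynomial circuits with POLYNOMIAL-size `P_c` proofs of all their
invariance identities) constructs `P_c` proofs gate by gate along a straight-line layout; a line
proved for a gate is USED by every parent of the gate, so the proofs must be genuine DAGs (a line,
once derived, is referenced by membership, not re-derived).  The tree's `PISystem.Provable`
calculus (`trans`, `add`, …) CONCATENATES sub-proofs and would blow up exponentially on shared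
gates.  This file provides the DAG-level interface:

* `PCR.Real S L n` — there is ONE proof in the system `S` of size `≤ n` among whose lines every
  equation of the list `L` occurs;
* one-step extensions `Real.axm / symm / trans / congrAdd / congrMul / refl` (the new line is
  consed onto `L`, its size added to `n`), weakening `Real.mono`, and the exit
  `Real.provable : Real S L n → (F, G) ∈ L → S.Provable F G (n + 2(|F|+|G|)) ⊤`;
* small chaining combinators (`trans₃`, `axmTrans`, …) used by the comb calculus (part 2), the
  dead-weight elimination (part 3) and the layout simulation (part 4).

Everything is generic in the system `S` (so it serves `P_f` and `P_c` alike); everything proved,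
no named facts.
-/

-- single-problem summit: `Summit.ValiantsHypothesis.ValiantsHypothesis.…` is the namespace by design (D-0017)
set_option linter.dupNamespace false

namespace Summit.ValiantsHypothesis.ValiantsHypothesis.Theorems

namespace PCR

open Literature.Computability.AlgebraicComplexity

universe u w

variable {𝔽 : Type u} {T : Type w} [CommSemiring 𝔽] {S : PISystem 𝔽 T}

/-- `Real S L n`: ONE proof in the system `S`, of size at most `n`, contains every equation of `L`
among its lines (a proof DAG realizing all of `L` at once; shared lines are paid for once).
[folklore] -/
def Real (S : PISystem 𝔽 T) (L : List (T × T)) (n : ℕ) : Prop :=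
  ∃ (Γ : List (T × T)) (_ : PIProof S Γ), L ⊆ Γ ∧ PISystem.linesSize S.size Γ ≤ n

/-- The empty proof realizes no lines at size `0`. [folklore] -/
theorem real_nil : Real S [] 0 :=
  ⟨[], .nil, List.nil_subset _, by simp⟩

/-- Weakening: fewer lines, larger size bound. [folklore] -/
theorem Real.mono {L L' : List (T × T)} {n n' : ℕ} (h : Real S L n) (hL : L' ⊆ L) (hn : n ≤ n') :
    Real S L' n' := by
  obtain ⟨Γ, π, hsub, hsz⟩ := h
  exact ⟨Γ, π, fun e he => hsub (hL he), hsz.trans hn⟩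

/-- Dropping the head line from the bookkeeping. [folklore] -/
theorem Real.tail {e : T × T} {L : List (T × T)} {n : ℕ} (h : Real S (e :: L) n) : Real S L n :=
  h.mono (List.subset_cons_self e L) le_rfl

/-- Extension by an axiom instance `F = G` of scheme `s` (cost `|F| + |G|`). [folklore] -/
theorem Real.axm {L : List (T × T)} {n : ℕ} (h : Real S L n) {s : PIAxiom} {F G : T}
    (hax : S.IsAxiom s F G) : Real S ((F, G) :: L) (n + (S.size F + S.size G)) := by
  obtain ⟨Γ, π, hsub, hsz⟩ := h
  refine ⟨(F, G) :: Γ, .axm s hax π, List.cons_subset_cons _ hsub, ?_⟩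
  simp only [PISystem.linesSize_cons]; omega

/-- Extension by R1 (symmetry) applied to a realized line (cost `|G| + |F|`). [folklore] -/
theorem Real.symm {L : List (T × T)} {n : ℕ} (h : Real S L n) {F G : T} (hm : (F, G) ∈ L) :
    Real S ((G, F) :: L) (n + (S.size G + S.size F)) := by
  obtain ⟨Γ, π, hsub, hsz⟩ := h
  refine ⟨(G, F) :: Γ, .symm (hsub hm) π, List.cons_subset_cons _ hsub, ?_⟩
  simp only [PISystem.linesSize_cons]; omega

/-- Extension by R2 (transitivity) applied to two realized lines (cost `|F| + |H|`). [folklore] -/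
theorem Real.trans {L : List (T × T)} {n : ℕ} (h : Real S L n) {F G H : T} (h₁ : (F, G) ∈ L)
    (h₂ : (G, H) ∈ L) : Real S ((F, H) :: L) (n + (S.size F + S.size H)) := by
  obtain ⟨Γ, π, hsub, hsz⟩ := h
  refine ⟨(F, H) :: Γ, .trans (hsub h₁) (hsub h₂) π, List.cons_subset_cons _ hsub, ?_⟩
  simp only [PISystem.linesSize_cons]; omega

/-- Extension by R3 (congruence for `+`) applied to two realized lines. [folklore] -/
theorem Real.congrAdd {L : List (T × T)} {n : ℕ} (h : Real S L n) {F₁ G₁ F₂ G₂ : T}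
    (h₁ : (F₁, G₁) ∈ L) (h₂ : (F₂, G₂) ∈ L) :
    Real S ((S.add F₁ F₂, S.add G₁ G₂) :: L) (n + (S.size (S.add F₁ F₂) + S.size (S.add G₁ G₂))) := by
  obtain ⟨Γ, π, hsub, hsz⟩ := h
  refine ⟨(S.add F₁ F₂, S.add G₁ G₂) :: Γ, .addRule (hsub h₁) (hsub h₂) rfl rfl π,
    List.cons_subset_cons _ hsub, ?_⟩
  simp only [PISystem.linesSize_cons]; omega

/-- Extension by R4 (congruence for `·`) applied to two realized lines. [folklore] -/
theorem Real.congrMul {L : List (T × T)} {n : ℕ} (h : Real S L n) {F₁ G₁ F₂ G₂ : T}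
    (h₁ : (F₁, G₁) ∈ L) (h₂ : (F₂, G₂) ∈ L) :
    Real S ((S.mul F₁ F₂, S.mul G₁ G₂) :: L) (n + (S.size (S.mul F₁ F₂) + S.size (S.mul G₁ G₂))) := by
  obtain ⟨Γ, π, hsub, hsz⟩ := h
  refine ⟨(S.mul F₁ F₂, S.mul G₁ G₂) :: Γ, .mulRule (hsub h₁) (hsub h₂) rfl rfl π,
    List.cons_subset_cons _ hsub, ?_⟩
  simp only [PISystem.linesSize_cons]; omega

/-- Extension by A1 `F = F`. [folklore] -/
theorem Real.refl {L : List (T × T)} {n : ℕ} (h : Real S L n) (F : T) :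
    Real S ((F, F) :: L) (n + (S.size F + S.size F)) :=
  h.axm (.inl (.a1 F))

/-- **Exit**: a realized line is provable (as the LAST line: re-derive it by two symmetries), within
the realized size plus `2(|F| + |G|)`, with no axiom budget. [folklore] -/
theorem Real.provable {L : List (T × T)} {n : ℕ} (h : Real S L n) {F G : T} (hm : (F, G) ∈ L) :
    S.Provable F G (n + 2 * (S.size F + S.size G) : ℕ) ⊤ := by
  obtain ⟨Γ, π, hsub, hsz⟩ := h
  refine ⟨(G, F) :: Γ, .symm List.mem_cons_self (.symm (hsub hm) π), ?_, fun _ => le_top⟩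
  simp only [PIProof.size_eq, PISystem.linesSize_cons]
  exact_mod_cast (by omega : S.size F + S.size G + (S.size G + S.size F + PISystem.linesSize S.size Γ) ≤
    n + 2 * (S.size F + S.size G))

/-! ### Chaining combinators

Each combinator realizes ONE new exposed line and hides its intermediate lines (they stay in the
proof, not in the bookkeeping list).  Costs are stated against a bound `B` on the sizes of the
terms involved. -/

/-- `F = G`, `G = H`, `H = K` realized ⇒ `F = K` (two R2 steps). [folklore] -/
theorem Real.trans₃ {L : List (T × T)} {n B : ℕ} (h : Real S L n) {F G H K : T}
    (h₁ : (F, G) ∈ L) (h₂ : (G, H) ∈ L) (h₃ : (H, K) ∈ L)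
    (hF : S.size F ≤ B) (hH : S.size H ≤ B) (hK : S.size K ≤ B) :
    Real S ((F, K) :: L) (n + 4 * B) := by
  have r1 := h.trans h₁ h₂
  have r2 := r1.trans (List.mem_cons_self) (List.mem_cons_of_mem _ h₃)
  refine r2.mono (fun e he => ?_) (by omega)
  rcases List.mem_cons.1 he with rfl | he
  · exact List.mem_cons_self
  · exact List.mem_cons_of_mem _ (List.mem_cons_of_mem _ he)

/-- `F = G`, `G = H`, `H = K`, `K = M` realized ⇒ `F = M`. [folklore] -/
theorem Real.trans₄ {L : List (T × T)} {n B : ℕ} (h : Real S L n) {F G H K M : T}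
    (h₁ : (F, G) ∈ L) (h₂ : (G, H) ∈ L) (h₃ : (H, K) ∈ L) (h₄ : (K, M) ∈ L)
    (hF : S.size F ≤ B) (hH : S.size H ≤ B) (hK : S.size K ≤ B) (hM : S.size M ≤ B) :
    Real S ((F, M) :: L) (n + 6 * B) := by
  have r1 := h.trans₃ h₁ h₂ h₃ hF hH hK
  have r2 := r1.trans (List.mem_cons_self) (List.mem_cons_of_mem _ h₄)
  refine r2.mono (fun e he => ?_) (by omega)
  rcases List.mem_cons.1 he with rfl | he
  · exact List.mem_cons_self
  · exact List.mem_cons_of_mem _ (List.mem_cons_of_mem _ he)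

/-- An axiom instance `G = H` chained after a realized line `F = G`. [folklore] -/
theorem Real.transAxm {L : List (T × T)} {n B : ℕ} (h : Real S L n) {s : PIAxiom} {F G H : T}
    (h₁ : (F, G) ∈ L) (hax : S.IsAxiom s G H)
    (hF : S.size F ≤ B) (hG : S.size G ≤ B) (hH : S.size H ≤ B) :
    Real S ((F, H) :: L) (n + 4 * B) := by
  have r1 := h.axm hax
  have r2 := r1.trans (List.mem_cons_of_mem _ h₁) List.mem_cons_self
  refine r2.mono (fun e he => ?_) (by omega)
  rcases List.mem_cons.1 he with rfl | he
  · exact List.mem_cons_self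
  · exact List.mem_cons_of_mem _ (List.mem_cons_of_mem _ he)

/-- The SYMMETRIC of an axiom instance `H = G` chained after a realized line `F = G`. [folklore] -/
theorem Real.transAxmSymm {L : List (T × T)} {n B : ℕ} (h : Real S L n) {s : PIAxiom} {F G H : T}
    (h₁ : (F, G) ∈ L) (hax : S.IsAxiom s H G)
    (hF : S.size F ≤ B) (hG : S.size G ≤ B) (hH : S.size H ≤ B) :
    Real S ((F, H) :: L) (n + 6 * B) := by
  have r1 := h.axm hax
  have r2 := r1.symm List.mem_cons_self
  have r3 := r2.trans (List.mem_cons_of_mem _ (List.mem_cons_of_mem _ h₁)) List.mem_cons_self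
  refine r3.mono (fun e he => ?_) (by omega)
  rcases List.mem_cons.1 he with rfl | he
  · exact List.mem_cons_self
  · exact List.mem_cons_of_mem _ (List.mem_cons_of_mem _ (List.mem_cons_of_mem _ he))

/-- An axiom instance realized as an exposed line (alias of `axm` with a uniform cost). [folklore] -/
theorem Real.axmB {L : List (T × T)} {n B : ℕ} (h : Real S L n) {s : PIAxiom} {F G : T}
    (hax : S.IsAxiom s F G) (hF : S.size F ≤ B) (hG : S.size G ≤ B) :
    Real S ((F, G) :: L) (n + 2 * B) :=
  (h.axm hax).mono (List.Subset.refl _) (by omega)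

/-- The symmetric of an axiom instance realized as an exposed line. [folklore] -/
theorem Real.axmSymmB {L : List (T × T)} {n B : ℕ} (h : Real S L n) {s : PIAxiom} {F G : T}
    (hax : S.IsAxiom s F G) (hF : S.size F ≤ B) (hG : S.size G ≤ B) :
    Real S ((G, F) :: L) (n + 4 * B) := by
  have r1 := h.axm hax
  have r2 := r1.symm List.mem_cons_self
  exact r2.mono (List.cons_subset_cons _ (List.subset_cons_self _ _)) (by omega)

/-- Symmetry with a uniform cost. [folklore] -/
theorem Real.symmB {L : List (T × T)} {n B : ℕ} (h : Real S L n) {F G : T} (hm : (F, G) ∈ L)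
    (hF : S.size F ≤ B) (hG : S.size G ≤ B) : Real S ((G, F) :: L) (n + 2 * B) :=
  (h.symm hm).mono (List.Subset.refl _) (by omega)

/-- Transitivity with a uniform cost. [folklore] -/
theorem Real.transB {L : List (T × T)} {n B : ℕ} (h : Real S L n) {F G H : T} (h₁ : (F, G) ∈ L)
    (h₂ : (G, H) ∈ L) (hF : S.size F ≤ B) (hH : S.size H ≤ B) : Real S ((F, H) :: L) (n + 2 * B) :=
  (h.trans h₁ h₂).mono (List.Subset.refl _) (by omega)

/-- Reflexivity with a uniform cost. [folklore] -/
theorem Real.reflB {L : List (T × T)} {n B : ℕ} (h : Real S L n) (F : T) (hF : S.size F ≤ B) :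
    Real S ((F, F) :: L) (n + 2 * B) :=
  (h.refl F).mono (List.Subset.refl _) (by omega)

/-- `+`-congruence with a uniform cost. [folklore] -/
theorem Real.congrAddB {L : List (T × T)} {n B : ℕ} (h : Real S L n) {F₁ G₁ F₂ G₂ : T}
    (h₁ : (F₁, G₁) ∈ L) (h₂ : (F₂, G₂) ∈ L) (hF : S.size (S.add F₁ F₂) ≤ B)
    (hG : S.size (S.add G₁ G₂) ≤ B) : Real S ((S.add F₁ F₂, S.add G₁ G₂) :: L) (n + 2 * B) :=
  (h.congrAdd h₁ h₂).mono (List.Subset.refl _) (by omega)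

/-- `·`-congruence with a uniform cost. [folklore] -/
theorem Real.congrMulB {L : List (T × T)} {n B : ℕ} (h : Real S L n) {F₁ G₁ F₂ G₂ : T}
    (h₁ : (F₁, G₁) ∈ L) (h₂ : (F₂, G₂) ∈ L) (hF : S.size (S.mul F₁ F₂) ≤ B)
    (hG : S.size (S.mul G₁ G₂) ≤ B) : Real S ((S.mul F₁ F₂, S.mul G₁ G₂) :: L) (n + 2 * B) :=
  (h.congrMul h₁ h₂).mono (List.Subset.refl _) (by omega)

/-- `+`-congruence with a REFLEXIVE right argument: `F = G` ⇒ `F + K = G + K`. [folklore] -/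
theorem Real.congrAddRight {L : List (T × T)} {n B : ℕ} (h : Real S L n) {F G : T} (K : T)
    (h₁ : (F, G) ∈ L) (hF : S.size (S.add F K) ≤ B) (hG : S.size (S.add G K) ≤ B) (hK : S.size K ≤ B) :
    Real S ((S.add F K, S.add G K) :: L) (n + 4 * B) := by
  have r1 := h.refl K
  have r2 := r1.congrAdd (List.mem_cons_of_mem _ h₁) List.mem_cons_self
  exact r2.mono (List.cons_subset_cons _ (List.subset_cons_self _ _)) (by omega)

/-- `+`-congruence with a REFLEXIVE left argument: `F = G` ⇒ `K + F = K + G`. [folklore] -/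
theorem Real.congrAddLeft {L : List (T × T)} {n B : ℕ} (h : Real S L n) {F G : T} (K : T)
    (h₁ : (F, G) ∈ L) (hF : S.size (S.add K F) ≤ B) (hG : S.size (S.add K G) ≤ B) (hK : S.size K ≤ B) :
    Real S ((S.add K F, S.add K G) :: L) (n + 4 * B) := by
  have r1 := h.refl K
  have r2 := r1.congrAdd List.mem_cons_self (List.mem_cons_of_mem _ h₁)
  exact r2.mono (List.cons_subset_cons _ (List.subset_cons_self _ _)) (by omega)

/-- `·`-congruence with a reflexive right argument. [folklore] -/
theorem Real.congrMulRight {L : List (T × T)} {n B : ℕ} (h : Real S L n) {F G : T} (K : T)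
    (h₁ : (F, G) ∈ L) (hF : S.size (S.mul F K) ≤ B) (hG : S.size (S.mul G K) ≤ B) (hK : S.size K ≤ B) :
    Real S ((S.mul F K, S.mul G K) :: L) (n + 4 * B) := by
  have r1 := h.refl K
  have r2 := r1.congrMul (List.mem_cons_of_mem _ h₁) List.mem_cons_self
  exact r2.mono (List.cons_subset_cons _ (List.subset_cons_self _ _)) (by omega)

/-- `·`-congruence with a reflexive left argument. [folklore] -/
theorem Real.congrMulLeft {L : List (T × T)} {n B : ℕ} (h : Real S L n) {F G : T} (K : T)
    (h₁ : (F, G) ∈ L) (hF : S.size (S.mul K F) ≤ B) (hG : S.size (S.mul K G) ≤ B) (hK : S.size K ≤ B) :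
    Real S ((S.mul K F, S.mul K G) :: L) (n + 4 * B) := by
  have r1 := h.refl K
  have r2 := r1.congrMul List.mem_cons_self (List.mem_cons_of_mem _ h₁)
  exact r2.mono (List.cons_subset_cons _ (List.subset_cons_self _ _)) (by omega)

end PCR

open Literature.Computability.AlgebraicComplexity in
/-- **Exit of the proof-DAG calculus, `P_c(ℂ)` form** (registered helper toward the necessity of
stub T′ `stub_invarianceProvableQP'`, crux `RestorationQP`): if one `P_c` proof of total size `≤ m`
contains all the lines `L`, then every line `F = G` of `L` has a `P_c` proof of size
`≤ m + 2(|F| + |G|)`. [folklore] -/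
theorem invarianceProvableQP_aux_realProvable : ∀ (n : ℕ) (L : List (PICircuit ℂ (Fin n × Fin n) × PICircuit ℂ (Fin n × Fin n))) (m : ℕ) (F G : PICircuit ℂ (Fin n × Fin n)), (∃ (Γ : List (PICircuit ℂ (Fin n × Fin n) × PICircuit ℂ (Fin n × Fin n))) (_ : PCProof ℂ (Fin n × Fin n) Γ), L ⊆ Γ ∧ PISystem.linesSize PICircuit.size Γ ≤ m) → (F, G) ∈ L → HasPCProofOfSize F G (m + 2 * (F.size + G.size)) := by
  intro n L m F G h hm
  have h' : PCR.Real (pcSystem ℂ (Fin n × Fin n)) L m := h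
  have := h'.provable hm
  exact_mod_cast this

end Summit.ValiantsHypothesis.ValiantsHypothesis.Theorems
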